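import Mathlib.MeasureTheory.Measure.Lebesgue.EqHaar
import Mathlib.Analysis.Normed.Operator.Basic
import HarnessLib

/-!
# The Jacobian bound `|det A| ≤ ‖A‖ⁿ` for linear changes of variables

Topic `Literature/Analysis/Matrix`; support file (all proved; no definitions; no named
facts). For a linear automorphism `A` of a finite-dimensional real normed space `E`
(`n = finrank E`, `μ` an additive Haar measure):

* `abs_det_le_norm_pow` — **Hadamard-type bound** `|det A| ≤ ‖A‖ⁿ` (from
  `μ(A(B₁)) = |det A| μ(B₁)` and `A(B₁) ⊆ B_{‖A‖}`);
* `abs_det_inv_le_norm_symm_pow` — `|det A|⁻¹ ≤ ‖A⁻¹‖ⁿ` for an equivalence — the factor of the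
  change of variables `∫ g(A x) dμ = |det A|⁻¹ • ∫ g dμ`
  (`Literature/Analysis/Fourier/FourierLinearChange.integral_comp_continuousLinearEquiv`).

Used for the per-point frame Jacobians in the mean-value step of Osterwalder–Schrader II, Ch. VI.1
((6.5)–(6.7)), where the constants must be explicit.

## References

* K. Osterwalder, R. Schrader, *Axioms for Euclidean Green's functions II*, Comm. Math. Phys. 42
  (1975) 281–305, Ch. VI.1. [OsterwalderSchraderCMP1975]

Everything here is folklore.
-/

noncomputable section

open MeasureTheory MeasureTheory.Measure Set Metric Module

namespace Literature.Analysis.Matrix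

variable {E : Type*} [NormedAddCommGroup E] [NormedSpace ℝ E] [FiniteDimensional ℝ E]

/-- **`|det A| ≤ ‖A‖ⁿ`** for a continuous linear endomorphism of a finite-dimensional real normed
space (`n = finrank`). [folklore] -/
theorem abs_det_le_norm_pow [Nontrivial E] (A : E →L[ℝ] E) : |LinearMap.det (A : E →ₗ[ℝ] E)| ≤ ‖A‖ ^ finrank ℝ E := by
  borelize E
  set μ : Measure E := MeasureTheory.Measure.addHaar with hμ
  have himg := addHaar_image_continuousLinearMap μ A (ball (0 : E) 1)
  -- `A(B₁) ⊆ closedBall 0 ‖A‖`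
  have hsub : A '' ball (0 : E) 1 ⊆ closedBall (0 : E) ‖A‖ := by
    rintro _ ⟨x, hx, rfl⟩
    rw [mem_closedBall_zero_iff]
    rw [mem_ball_zero_iff] at hx
    calc ‖A x‖ ≤ ‖A‖ * ‖x‖ := A.le_opNorm x
      _ ≤ ‖A‖ * 1 := mul_le_mul_of_nonneg_left hx.le (norm_nonneg _)
      _ = ‖A‖ := mul_one _
  have hle := measure_mono (μ := μ) hsub
  rw [himg, addHaar_closedBall μ (0 : E) (norm_nonneg A)] at hle
  have hB0 : μ (ball (0 : E) 1) ≠ 0 := (measure_ball_pos μ 0 one_pos).ne'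
  have hBf : μ (ball (0 : E) 1) ≠ ⊤ := measure_ball_lt_top.ne
  have h : ENNReal.ofReal |LinearMap.det (A : E →ₗ[ℝ] E)| ≤ ENNReal.ofReal (‖A‖ ^ finrank ℝ E) := by
    have h1 := mul_le_mul_left hle (μ (ball (0 : E) 1))⁻¹
    rwa [mul_assoc, mul_assoc, ENNReal.mul_inv_cancel hB0 hBf, mul_one, mul_one] at h1
  rwa [ENNReal.ofReal_le_ofReal_iff (by positivity)] at h

/-- **`|det A|⁻¹ ≤ ‖A⁻¹‖ⁿ`** for a continuous linear equivalence. [folklore] -/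
theorem abs_det_inv_le_norm_symm_pow [Nontrivial E] (A : E ≃L[ℝ] E) :
    |(LinearMap.det ((A : E →L[ℝ] E) : E →ₗ[ℝ] E))⁻¹| ≤ ‖(A.symm : E →L[ℝ] E)‖ ^ finrank ℝ E := by
  have h := abs_det_le_norm_pow (A.symm : E →L[ℝ] E)
  have hdet : LinearMap.det ((A.symm : E →L[ℝ] E) : E →ₗ[ℝ] E) = (LinearMap.det ((A : E →L[ℝ] E) : E →ₗ[ℝ] E))⁻¹ := by
    have : ((A.symm : E →L[ℝ] E) : E →ₗ[ℝ] E) = ((A.toLinearEquiv.symm : E ≃ₗ[ℝ] E) : E →ₗ[ℝ] E) := rfl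
    rw [this, LinearEquiv.det_coe_symm]
    rfl
  rwa [hdet] at h

end Literature.Analysis.Matrix
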